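import Summits.FinalStateConjecture.FinalStateConjecture.Theses.PhotonSphereChannels
import Summits.FinalStateConjecture.FinalStateConjecture.Theorems.PhotonSphereChannelsKerrDevDefs
import Summits.FinalStateConjecture.FinalStateConjecture.Theorems.PhotonSphereChannelsDarkFutureDefs
import Summits.FinalStateConjecture.FinalStateConjecture.Theorems.PhotonSphereChannelsChannelsResolveTameDevelopmentsRRayClauseSplit
import Summits.FinalStateConjecture.FinalStateConjecture.Theorems.PhotonSphereChannelsChannelsResolveTameDevelopmentsRLateSilentCone
import HarnessLib.Audit

/-!
# Line `dark-future-exactness` — skeleton for crux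
`PhotonSphereChannels.ChannelsResolveTameDevelopmentsR` (stmt-FinalStateConjecture-17430, K2R-T2)

Crux-plan (planner-cruxplan-stmt-FinalStateConjecture-17430-dark-future-exactnes-0, 2026-08-17) for the
crux idea card `Cruxes/ChannelsResolveTameDevelopmentsR/Ideas/dark-future-exactness.md` (ideator 5,
gen 1 / round 2; triage r2: 1 fail (r2-1, typing + overclaim) / 2 pass (r2-2, r2-3 deciding), panel
tally 2–1). Line card: `Lines/dark-future-exactness.md`.

## What the crux is, and what this line proves

K2R-T2 is `K1R → Φ_T2` and `K1R` is a theorem of the tree (`UniformPhotonSphereChannelsR_holds`), so the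
crux IS tame T2 resolution (`Disproof.k2R_iff_tameResolution`, `K2REquivPhi`). Its consequent carries the
ray-closure clause (C) `RaysStayInClosure`, which FACTORS OUT onto the existing cross-route item
`SettledExteriorHoldsRays` (stmt-FinalStateConjecture-17673) by the LANDED split
`Theorems.ChannelsResolveTameDevelopmentsR.RayClause.channelsResolveTameDevelopmentsR_of_rayClause`
(p137580/p137749: `17673-body → K2R♭ → crux`). This skeleton therefore proves K2R♭ (the crux with (C)
deleted) from six stubs, DOCKS (C) as the seventh stub (`stub_settledExteriorHoldsRays` = item 17673
verbatim, closes by `exact` when that item is proved), and discards the antecedent `K1R`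
(`intro _hK1R`, `Disproof.k2R_of_tameResolution` shape). `ChannelsResolveTameDevelopmentsR_of` concludes
the route decl BY NAME.

## The line: darkness after ONE epoch is exactness (the bridge of cluster A), inside the hull + clopen architecture

Cluster A (`isolated-kerr-connected-hull` / `kerr-isolation-dichotomy`, both dead, `Lines/*-dead.md`)
reduced Φ to: silent hull elements exist (A) + the Kerr locus is CLOPEN in the connected based hull
(K) + it is nonempty (the open core) + endgame (T). Closedness is cheap, connectedness is landed
(`…RHullDichotomy`, `…RHullConnectednessIVT`); OPENNESS = isolation = the BRIDGE "a dark eternal tame end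
close to Kerr at one place is Kerr", which no card claimed (TRIAGE-r1-3 finding 2) and on which IKCH
(stubs I `KerrIsolation` + G `WindowToGlobalBridge`: eternal two-sided linearised rigidity + two-sided
orbital stability in the dark class) and KID (S3, inert under far re-basing) died. THIS LINE supplies
the bridge with a lever not used on this crux before (card, passed r2-2/r2-3):

* **B `stub_darkFutureExactness`** (THE CARD; weaker than Φ): an eternal, all-orders-tame, SILENT end
  which at ONE unit epoch of its own clock is `r`-weighted `C^k`-close (weight `r^{β+m}` on `D^m`,
  `β < 2` = below the mass order, ACROSS the horizon down to `r = M'`) to a sub-extremal Kerr has an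
  EXACTLY Kerr domain of outer communications with nearby parameters. Mechanism: forward nonlinear
  stability from the slab (Klainerman–Szeftel `klainerman_szeftel_kerr_stability_small_a_cauchy` for
  `|a| < a₀M`; `hintz_kerr_stability_subextremal_cauchy` (claim, under review) / barrier
  `SlowlyRotatingKerrFrontier` beyond) makes the future converge to SOME Kerr; darkness (zero flux
  through `𝓘⁺` and `𝓗⁺`, `EndDatum.IsSilent`) pins the scattering data to Kerr's, so the deviation
  VANISHES on `J⁺(slab)` (linear model a theorem: Dimock 1985, Masaood 2022/2024; region form re-derived
  by the triage, Finding C; 1+1 shadow LANDED: `RW.lateSilentConeIsEmpty`, re-exported in §2c); and an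
  eternal silent tame end whose d.o.c. is EVENTUALLY exact Kerr is exact Kerr (backward extension by
  re-running the small-data forward problem from earlier slabs, Finding E of r2-3 — NOT "free by Cauchy
  rigidity"). The stub is ONE registered statement; its foreseen gate-level cut
  `B ⇐ B1 ForwardExactness ∧ B2 BackwardExtension` is typed and PROVED in §2b.
* **P `stub_hullNearKerrIsSlabClose`** (the PRODUCER, r2-1/2/3 `sharpen`, KID-S3's honest successor):
  in a development as in Φ, along a horizon generator path, a silent horizon-hull element admitting an
  EXTERIOR window `{r₊ + η < r < W, |t*| < W}` that is `C²`-`δ`-close to Kerr `(M, a)` inside its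
  d.o.c. is slab-close (B's hypothesis, any order `k`, any weight `β < 2`) to a nearby Kerr `(M', a')`:
  far alignment at order `r⁻²` after absorbing mass/boost/translation into the chart, UNIFORM far
  constants over the class (`E.R, E.C ≤ Λ 0`: no invisible far companion), collar closeness from hull
  provenance + red-shift, higher orders by interpolation against all-orders tameness. `P ∘ B` = window
  isolation along generators (`WindowIsolationAlong`, derived in §4 by pure logic).
* **A `stub_silentHull`** (producers; arriving, route seat 0): silent hull elements in ONE all-orders
  class along outer sequences and along horizon generator paths, shadowing. Clause "all orders" is
  Finding G of r2-3 (the crux's (ii) is `C³`; KS needs `H^s`, `s` existential): either the a-priori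
  late-time regularity upgrade, or trivial after the planner-level restatement of (ii) — flagged, not
  hidden.
* **K `stub_kerrLocusClopen`** (∀→∃ conversion, the card's claim on the crux): precompactness + window
  isolation + ONE sub-extremal Kerr horizon-hull element along `γ` ⇒ ALL horizon-hull elements along `γ`
  are Kerr with one `(M, a)` (compact connected `Ω_γ`, Kerr locus closed, pinned by the area/mass budgets,
  open by window isolation; no Birkhoff minimality — IKCH's trimming defect does not arise).
* **N `stub_someLimitIsKerr`** (HONEST OPEN CORE, `[open-problem]`, = the card's Transfer C⁺
  NonEmptiness): (N1) along every horizon generator path SOME horizon-hull element is a SUB-EXTREMAL Kerr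
  d.o.c. (∃ over epochs — averaged estimates / Birkhoff selection / variational selection may feed it;
  ⊇ IKCH-R for one element and (i) in ω-limit form); (N2) horizonless silent outer hull elements are
  Minkowski or Kerr (census class (D), IKCH R2 verbatim).
* **T `stub_tameEndgame`** (IKCH T with `IsFutureOriented`): all-Kerr/flat hull with constant parameters
  per generator ⇒ the K2R♭ conclusion (honest exhaustive future-oriented decomposition).
* **C `stub_settledExteriorHoldsRays`** = item stmt-FinalStateConjecture-17673 verbatim (dock).

COMPOSITION (§4, sorry-free logic): A's class; `P ∘ B ⇒ WindowIsolationAlong`; per horizon path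
`K (N1-witness) ⇒` one `(M, a)`; outer elements: empty horizon `⇒ N2`, else shadow (A(c)) onto a
generator; `T ⇒ K2R♭`; `RayClause…of_rayClause C ⇒` the crux by name.

## Reshape 1 (lead c7, prover-line-stmt-FinalStateConjecture-17430-c7-0, 2026-08-17, after wave 1)

* **Depth parameter (P′/B′).** Stub-worker P proved (kernel-checked, `work/stubs/stub_hullNearKerrIsSlabClose.lean`,
  `not_hullNearKerrIsSlabClose_of_trimWitness` + `IsHorizonHullElement.trim`) that the ORIGINAL producer P was false
  wherever the line is not vacuous: hull elements carry no covering clause (`Spacetime.SubconvergesLocallyTo.restrict'`,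
  p94072), so a Kerr-d.o.c. horizon-hull element trimmed to `{r > r₊ − 2c·r₀}` is again a horizon-hull element along the
  same `γ ∘ s`, window-close for every `(W, η, δ)`, but admits no slab chart of the penetrating region `{r > M'}` (depth
  `√(M'² − a'²) ≫ r₀`; Kretschmann pinning) — IKCH's trimming defect re-entering through P's collar clause only (B, K, N
  conclude on `E.doc` and are immune). Repair (a) of the worker, adopted: `penetratingBackground M a ρ` / `IsSlabClose … ρ …`
  carry a DEPTH `ρ`; P′ ANNOUNCES `∃ ρ ∈ (r₋, r₊)` (depending on the development, the class, the path and `(M, a)`: the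
  collar of a window-close class member is pinned by its clock-adapted tame balls to a uniform positive depth, immune to
  trimming) right after `0 < M → |a| < M →`; B′ holds `∀ ρ ∈ (r₋, r₊)` (as `klainerman_szeftel_kerr_stability_small_a_cauchy`,
  stated `∀ r₀ ∈ Ioo r₋ r₊`); `windowIsolationAlong_of_producer_bridge` threads the quantifier; K, N, C and §4 unchanged.
* **Outer-region guard (A′/T′).** Stub-worker T showed (landed p150272 `…RTameEndgame`:
  `exists_isFutureEscaping_iff_outerRegion_nonempty`) that on the fibre `outerRegion 𝒟 = ∅` the whole hypothesis block
  (a)–(d) of T is vacuous (no future-escaping sequences, no horizon paths), so T silently contained Φ♭ there; `DevHyp.scri`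
  is the SOJOURN form of complete `𝓘⁺` (NullInfinity.lean) and asserts no complete ray, and nothing in the tree derives
  `(outerRegion 𝒟).Nonempty` (in print only for the Klainerman–Nicolò class: `klainerman_nicolo_exterior_null_completeness`,
  not for the Christodoulou-admissible class). Since an honest `N = 0` decomposition itself yields a complete ray, the
  crux CONTAINS "DevHyp ⇒ outer region nonempty"; it is now an explicit conjunct of the producer stub A′ and a hypothesis of
  T′ (no eighth stub).
* **Reshape 2 (after wave 2): the producer answers with a REPRESENTATIVE.** Stub-worker P′ refuted the reshaped
  producer again, now WITHOUT trimming (landed p154272 `…RHullTrimming`: `IsHorizonHullElement.of_sameCarrier/.reclock`,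
  `not_hullNearKerrIsSlabClose_of_witness`): hull membership does not see the clock, the clock-adapted tame balls only
  force the lapse window `N² ∈ [1/2, 3/2]` (slope `|F'| ≤ 0.6` for stationary radial clocks `x⁰ + F(r)`), so a Kerr-doc
  element RE-CLOCKED with drift `|F(r₊) − F(R)| > 2` has a unit clock-epoch of native `t*`-width `> 4` that no `ε`-slab
  chart (rigidly `φ_{t₀} ∘ O(3) ∘ KS` up to `o(1)` at `k ≥ 3`) covers; and re-clocked trimming can NOTCH the pinned collar
  `v`-periodically with depth `→ 0` in classes with `Λ₁M, Λ₃M³ ≳ 1`. Both attack the INPUT's accidental structure, never its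
  d.o.c.; the line's consumer needs `IsKerrDoc … E.doc` only. Repair adopted: P″ lets the producer answer with ANOTHER
  horizon-hull element `(𝓢', E', p')` along `γ` (its canonical representative: un-notched carrier, negligible-drift clock —
  minimal inward bending `F' ≥ M/r − 1/2` on the collar costs drift `≈ d²/8M`) which IS slab-close, together with the
  d.o.c. transfer `∀ M'' a'', IsKerrDoc 𝓢' E'.doc M'' a'' → IsKerrDoc 𝓢 E.doc M'' a''` (the producer knows the embedding);
  B′ and `IsSlabClose` unchanged; `windowIsolationAlong_of_producer_bridge` re-proved (pure logic). **Reshape 2b (after wave 3):**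
  stub-worker P″ found NO witness against P″ (levers: far-chart re-choice, class exhaustion, announcement order, order-1 clock game —
  universal horizon bound `N·K_θ̂θ̂ ≥ (1 − o(1))/4M`) and landed p156555 `…RProducerRepresentative` (`Schw.isSlabClose_of_far`: the exact
  Schwarzschild end IS slab-close with `δ = 0` from every depth — anti-vacuity of B′/P″; `P″ ⇐ C1 ∧ C2`; `P′ ⇒ P″`); its free hardening
  against a residual clock-optimality game at orders `≥ 2` is adopted: the representative may live in ANOTHER class `(Λ', r₀')` (B′ is
  `∀ Λ r₀`, so the composition is unchanged — `windowIsolationAlong_of_producer_bridge` instantiates B′ at `(Λ', r₀')`).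
* Wave-1 landings (`--supports 17430`): p149021 `…RPinnedClopenLocus` (K's abstract clopen/pinning step), p149947
  `…RSettledExteriorHoldsRays` (narrow dock: the crux consumes only the chart-free half of item 17673), p150201
  `…ROuterVacuumLimits` (A(a)'s local vacuum limits under all-orders (ii)), p150272 `…RTameEndgame` (`IsFutureOriented`
  automatic at `N = 0`, no dust at `N = 0`, escaping ⇔ outer nonempty).

## New local vocabulary (§1 — landed as `Theorems/PhotonSphereChannelsDarkFutureDefs.lean`, p151595; everything else is `TameHull`/`KerrDev`'s)

`IsTameEndOrder` (tame at order `k`), `IsTameClass` (all orders, uniform far constants),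
`penetratingBackground`, `exteriorWindow`, `IsExteriorWindowClose`, `IsSlabClose`,
`IsEventuallyKerrDoc`; `IsSilentHullElement`, `horizonOf`, `IsHorizonPath`,
`IsHorizonHullElementAlong/IsHorizonHullElement` (IKCH's, over the all-orders class), `OuterHullExists`,
`GeneratorHullExists`, `OuterHullShadowed`, `WindowIsolationAlong`; B1/B2 `ForwardExactness`,
`BackwardExtension`.

## Disproof used (`Cruxes/ChannelsResolveTameDevelopmentsR/Disproof.lean`, cdisprove v3.1, c1–c3)

(a) the ONE `_false_without_` theorem `tameResolution_false_without_maximal_and_complete`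
({`IsMaximal`, complete `𝓘⁺`} jointly load-bearing; slab witness): honoured — `IsMaximal` and
`HasCompleteNullInfinity` are consumed by A (`DevHyp`: budgets ⇒ silence of limits, existence of hull
ends near `i⁰`), by T (`O = exteriorOf`, exhaustion) and by C (item 17673 keeps both); the line does NOT
consume only (i), (ii), `Ric = 0` (§4's refuted shape). (b) §8.4 `tame_hypothesis_boost_blind`
(LANDED `Negative/TameChartsBoostBlind`): every end-side stub is typed over CLOCK-ADAPTED centred balls
(`IsTameEnd.tame`, `IsTameEndOrder.tame`), and non-collapse is never extracted from (ii) — the upgrade is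
A's flagged burden. (c) §7 / `Negative/SilenceCalculus` (`not_oneTimeSilenceZero`): no stub has a one-time
silence hypothesis; silence of an `EndDatum` is eternal (`IsNonRadiating` uniform in `x⁰`); the landed
1+1 shadow `RW.lateSilentConeIsEmpty` concludes on the forward cone of the silent apex only. (d) §8.2
`bag_exposure` / clause (C): not engaged inside the line — (C) is docked to item 17673 via the landed
split (the operator-level exposure stays on that shared item). (e) `Negative/KerrIsolationClosurePoints`
(p120436: isolation statements with closure-point / collar conclusions are refuted by two-ended members
perturbed in the second exterior): B, K, N conclude `IsKerrDoc … E.doc` ONLY (no closure-point or collar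
clause); P's window is EXTERIOR and mapped INTO `E.doc`, its collar output is development-guarded
(horizon-hull elements of a development as in Φ). (f) `Negative/EmptyHorizonEnd` (predecessor crux,
p76400): the horizonless alternative N2 is restricted to hull elements of developments as in Φ and keeps
the Kerr disjunct (IKCH R2 repair). (g) §5 census (B)(U)(D)(E): (U)/(B) near sub-extremal Kerr are
EXCLUDED by B (isolation, consistent with AIK 2010); away from Kerr they sit in N1; (D) is N2; (E)-wide
companions are P's uniform-far-constant clause. Negatives index (`ledger negatives`): 1 entry
(stmt-10045, fixed-ball K1) — no stub uses a channel inequality.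
-/

noncomputable section

-- the operator-norm instance on `E4 →L[ℝ] E4 →L[ℝ] ℝ` needs one more level of pending
-- instance problems than the default (as in `BoundedGeometry.lean` / `TameHullDefs`)
set_option maxSynthPendingDepth 3
set_option linter.dupNamespace false

open Set Filter Function TopologicalSpace Manifold Bundle
open scoped Topology Manifold ContDiff ENNReal NNReal

namespace Summit.FinalStateConjecture.FinalStateConjecture.Cruxes.ChannelsResolveTameDevelopmentsR.DarkFutureExactness

open Literature.Geometry.Lorentzian
open Summit.FinalStateConjecture.FinalStateConjecture.Theorems.TameHull
open Summit.FinalStateConjecture.FinalStateConjecture.Theses.PhotonSphereChannels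
  (ChannelsResolveTameDevelopmentsR UniformPhotonSphereChannelsR)

/-! ### §1 Local vocabulary — LANDED as `Theorems/PhotonSphereChannelsDarkFutureDefs.lean` (p151595, namespace
`…Theorems.TameHull`, opened above): `IsTameEndOrder`, `IsTameClass`, `penetratingBackground`, `exteriorWindow`,
`IsExteriorWindowClose`, `IsSlabClose`, `IsEventuallyKerrDoc`, `IsSilentHullElement`, `horizonOf`, `IsHorizonPath`,
`IsHorizonHullElementAlong`, `IsHorizonHullElement`, `OuterHullExists`, `GeneratorHullExists`, `OuterHullShadowed`,
`WindowIsolationAlong` (texts byte-identical to the registered signatures; stub files import that module). -/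

/-! ### §2 Stub statements (named `def … : Prop`) and the registered stubs `stub_*` (same text) -/

/-- **Stub A — `SilentHull` (producers; XL; ARRIVING — route seat 0's crux-A producers, IKCH A).** For
an MGHD of admissible data with complete `𝓘⁺`, (i), (ii) (`DevHyp`) there is ONE all-orders class
`(Λ, r₀)` (`IsTameClass`: eternal `C³`-tame vacuum end with clock-adapted centred balls, uniform far
constants `E.R, E.C ≤ Λ 0`, tame at every order `k` with constant `Λ k`) such that: (a) every
future-escaping sequence of OUTER points has a SILENT hull element based in the closed d.o.c. (two-sided
non-radiating far chart + non-expanding shear-free horizon + red/cold, from the Bondi-mass-loss and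
area budgets made pointwise on limits by Barbalat — uses `IsMaximal` + complete `𝓘⁺`); (b) along every
HORIZON GENERATOR PATH `γ` of `𝒟` and every `sₙ → +∞` there is a silent horizon-hull element BASED ON
ITS OWN HORIZON (precompactness = hypothesis (ii); horizon lineage); (c) SHADOWING: an outer silent hull
element with nonempty horizon is, re-based, a horizon-hull element along some generator path (so such
paths exist); and (Reshape 1, lead c7) FIRST OF ALL the outer region is NONEMPTY — some normalised null ray from `Σ` is
future complete (exterior stability near `i⁰`; in print for the Klainerman–Nicolò class only,
`klainerman_nicolo_exterior_null_completeness`; the sojourn form of `DevHyp.scri` does not assert it, and without it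
every later stub is vacuous while Φ♭ is not). REGULARITY CLAUSE (Finding G of TRIAGE-r2-3, the standing crux-level flag of the IKCH dead
note): (ii) is `C³`, the class is all-orders — from (ii) as typed this contains the a-priori late-time
regularity upgrade of tame complete vacuum exteriors (open); after the planners' restatement "(ii) at
all orders" it is Arzelà–Ascoli at each order. Sub-bets inherited from IKCH A / seat 0: the clock is
CONSTRUCTED (Bondi rest frame inward), `t`-uniform far tameness on `Kerr.region 0 R`, global gluing of
local limits, existence + future-escape of horizon generators (`…RHorizonGeneratorSegments` gives
forward segments only). Why it might fail: the uniform far constants (`E.R ≤ Λ 0`) fail if curvature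
concentrations of 𝒟 recede to unbounded distance from the horizon along a subsequence (an eternal
widening binary as an ω-limit — census (E), radiation-reaction folklore only). Size: XL.
[cite: Anderson2004, Thm 5.1] [cite: ChruscielEtAl2001, Thm 1.1] [cite: ChristodoulouKlainerman1993, Ch. 17] -/
def SilentHull : Prop :=
    ∀ (X : Type) [TopologicalSpace X] [ChartedSpace E3 X] [IsManifold (𝓡 3) ∞ X] [T2Space X]
      [SecondCountableTopology X] [ConnectedSpace X], ∀ D ∈ admissibleVacuumData X,
      ∀ (𝒟 : VacuumCauchyDevelopment D) [𝒟.metric.HasLeviCivita], DevHyp 𝒟 →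
        (outerRegion 𝒟).Nonempty ∧
        ∃ (Λ : ℕ → ℝ≥0) (r₀ : ℝ), 0 < r₀ ∧ OuterHullExists 𝒟 Λ r₀ ∧ GeneratorHullExists 𝒟 Λ r₀ ∧
          OuterHullShadowed 𝒟 Λ r₀

/-- Registered stub `stub_silentHull` (statement = `SilentHull`, verbatim). [folklore] -/
theorem stub_silentHull :
    ∀ (X : Type) [TopologicalSpace X] [ChartedSpace E3 X] [IsManifold (𝓡 3) ∞ X] [T2Space X]
      [SecondCountableTopology X] [ConnectedSpace X], ∀ D ∈ admissibleVacuumData X,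
      ∀ (𝒟 : VacuumCauchyDevelopment D) [𝒟.metric.HasLeviCivita], DevHyp 𝒟 →
        (outerRegion 𝒟).Nonempty ∧
        ∃ (Λ : ℕ → ℝ≥0) (r₀ : ℝ), 0 < r₀ ∧ OuterHullExists 𝒟 Λ r₀ ∧ GeneratorHullExists 𝒟 Λ r₀ ∧
          OuterHullShadowed 𝒟 Λ r₀ := by
  sorry

/-- **Stub P — `HullNearKerrIsSlabClose` (THE PRODUCER; infrastructure-grade, L–XL; TRIAGE-r2-1
`sharpen` (3), r2-2 (c), r2-3 (2): "where openness of 𝒦 now lives, KID-S3's honest successor").** For a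
development as in Φ, a class `(Λ, r₀)`, a horizon generator path `γ`, an order `k`, a weight `β < 2`, a
sub-extremal `(M, a)` there is a DEPTH `ρ ∈ (r₋(M, a), r₊(M, a))` (Reshape 1: announced by the producer — the collar of
a window-close class member is pinned by its clock-adapted tame balls to a uniform positive Kerr–Schild depth below `r₊`,
immune to trimming; the original fixed depth `M = (r₋ + r₊)/2` was refuted by trimming) such that for every order `k`,
weight `β < 2` and tolerance `ε`, there is an exterior window size `(W, η, δ)` such that for every
(silent, all-orders-tame, horizon-based) horizon-hull element along `γ` that contains an exterior window
`{r₊ + η < r < W, |t*| < W}` `C²`-`δ`-close to Kerr `(M, a)` inside its d.o.c. THERE IS (Reshape 2: the producer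
answers with a REPRESENTATIVE — hull membership along `γ` is blind to re-clocking and trimming of the carrier, which
refuted every version asking slab-closeness of the input itself) a horizon-hull element `(𝓢', E', p')` along `γ`
which, at some epoch `c` of its clock, is `ε`-slab-close from depth `ρ` at order `k` and weight `β` to a Kerr
`(M', a')` with `|M' − M| + |a' − a| ≤ ε` (`IsSlabClose`: penetrating chart of `{r > ρ}`, one unit clock-epoch of
the d.o.c. covered, weighted smallness out to `r = ∞`) and whose d.o.c. TRANSFERS exact-Kerr-ness back:
`IsKerrDoc 𝓢' E'.doc M'' a'' → IsKerrDoc 𝓢 E.doc M'' a''` for all `(M'', a'')` (the producer's representative is the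
development's own un-notched limit along the same subsequence with a negligible-drift clock, into which the input
embeds isometrically with the same d.o.c.; Reshape 2b: the representative may belong to another all-orders class `(Λ', r₀')`,
announced with `ρ`). Content, each a genuine lemma: (1) FAR ALIGNMENT — a two-sided
non-radiating vacuum end whose near zone is `δ`-close to Kerr `(M, a)` has, after absorbing mass (`M'`),
boost and translation into the chart, `r^{β+m}‖D^m(Ψ^*g − g_{M',a'})‖` small on the epoch for every
`β < 2` (mass order; no multipole matching needed below `r⁻²`); the uniform far constants of the class
bound the tail beyond `W` by `Λ 0 · W^{β−2}`; (2) NO FAR COMPANION — `E.R ≤ Λ 0` confines any second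
concentration to radius `≤ Λ 0`, inside the window once `W > Λ 0`, where `δ`-closeness to ONE Kerr
excludes it; (3) COLLAR — closeness on `{M' < r ≤ r₊}` at a late chart time from exterior closeness on a
long window + tameness, by hull provenance (the collar of a horizon-hull element of 𝒟 is a limit of
regions in `D⁺` of earlier outer data) and the red-shift along the horizon (the cold branch of `IsSilent`
is excluded by `C²`-closeness to sub-extremal Kerr down to `r₊ + η`); (4) ORDER — `C²`-closeness +
uniform `C^{k+1}` bounds (class) ⇒ `C^k`-closeness by interpolation; (5) COVERAGE of the clock-epoch by
the chart (clock vs `t*` drift bounded after alignment). Why it might fail: (1) at `β` close to `2` needs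
the time-dependent `r⁻²` part of a dark end's far field to be pure gauge/angular momentum (linear model:
bounded two-sided non-radiating exterior wave ⇒ static multipoles, Rellich-type); (3) is unprotected for
two-ended limits (cf. `Negative/KerrIsolationClosurePoints`) and relies on hull provenance. Size: L–XL.
[cite: arXiv:1504.04592, Prop. 3.5] [cite: DafermosRodnianski2008, §7.1 Thm. 7.1] [cite: KlainermanSzeftel2023, §3.1.1] -/
def HullNearKerrIsSlabClose : Prop :=
    ∀ (X : Type) [TopologicalSpace X] [ChartedSpace E3 X] [IsManifold (𝓡 3) ∞ X] [T2Space X]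
      [SecondCountableTopology X] [ConnectedSpace X], ∀ D ∈ admissibleVacuumData X,
      ∀ (𝒟 : VacuumCauchyDevelopment D) [𝒟.metric.HasLeviCivita], DevHyp 𝒟 →
        ∀ (Λ : ℕ → ℝ≥0) (r₀ : ℝ) (γ : ℝ → 𝒟.carrier), IsHorizonPath 𝒟 γ →
          ∀ M a : ℝ, 0 < M → |a| < M →
            ∃ (ρ : ℝ) (Λ' : ℕ → ℝ≥0) (r₀' : ℝ), Kerr.rMinus M a < ρ ∧ ρ < Kerr.rPlus M a ∧
            ∀ (k : ℕ) (β : ℝ), β < 2 → ∀ ε > (0 : ℝ),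
            ∃ W η δ : ℝ, 0 < η ∧ 0 < δ ∧
              ∀ (𝓢 : Spacetime.{0} 4) (E : EndDatum 𝓢) (p : 𝓢.carrier),
                IsHorizonHullElement 𝒟 Λ r₀ γ 𝓢 E p → IsExteriorWindowClose 𝓢 E M a W η δ →
                  ∃ (𝓢' : Spacetime.{0} 4) (E' : EndDatum 𝓢') (p' : 𝓢'.carrier) (M' a' c : ℝ),
                    IsHorizonHullElement 𝒟 Λ' r₀' γ 𝓢' E' p' ∧ |M' - M| + |a' - a| ≤ ε ∧
                      IsSlabClose 𝓢' E' M' a' ρ k β c ε ∧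
                        ∀ M'' a'' : ℝ, IsKerrDoc 𝓢' E'.doc M'' a'' → IsKerrDoc 𝓢 E.doc M'' a''

/-- Registered stub `stub_hullNearKerrIsSlabClose` (statement = `HullNearKerrIsSlabClose`, verbatim). [folklore] -/
theorem stub_hullNearKerrIsSlabClose :
    ∀ (X : Type) [TopologicalSpace X] [ChartedSpace E3 X] [IsManifold (𝓡 3) ∞ X] [T2Space X]
      [SecondCountableTopology X] [ConnectedSpace X], ∀ D ∈ admissibleVacuumData X,
      ∀ (𝒟 : VacuumCauchyDevelopment D) [𝒟.metric.HasLeviCivita], DevHyp 𝒟 →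
        ∀ (Λ : ℕ → ℝ≥0) (r₀ : ℝ) (γ : ℝ → 𝒟.carrier), IsHorizonPath 𝒟 γ →
          ∀ M a : ℝ, 0 < M → |a| < M →
            ∃ (ρ : ℝ) (Λ' : ℕ → ℝ≥0) (r₀' : ℝ), Kerr.rMinus M a < ρ ∧ ρ < Kerr.rPlus M a ∧
            ∀ (k : ℕ) (β : ℝ), β < 2 → ∀ ε > (0 : ℝ),
            ∃ W η δ : ℝ, 0 < η ∧ 0 < δ ∧
              ∀ (𝓢 : Spacetime.{0} 4) (E : EndDatum 𝓢) (p : 𝓢.carrier),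
                IsHorizonHullElement 𝒟 Λ r₀ γ 𝓢 E p → IsExteriorWindowClose 𝓢 E M a W η δ →
                  ∃ (𝓢' : Spacetime.{0} 4) (E' : EndDatum 𝓢') (p' : 𝓢'.carrier) (M' a' c : ℝ),
                    IsHorizonHullElement 𝒟 Λ' r₀' γ 𝓢' E' p' ∧ |M' - M| + |a' - a| ≤ ε ∧
                      IsSlabClose 𝓢' E' M' a' ρ k β c ε ∧
                        ∀ M'' a'' : ℝ, IsKerrDoc 𝓢' E'.doc M'' a'' → IsKerrDoc 𝓢 E.doc M'' a'' := by
  sorry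

/-- **Stub B — `DarkFutureExactness` (THE CARD's BRIDGE; L–XL; passed TRIAGE-r2-2/r2-3; weaker than Φ).**
In every all-orders class `(Λ, r₀)`, for every SUB-EXTREMAL `(M, a)` and (Reshape 1) for every DEPTH
`ρ ∈ (r₋(M, a), r₊(M, a))` of the penetrating slab there are an order `k` and a weight `β < 2` such that for every tolerance `ε` there is `δ > 0` (locally uniform: valid for all centres
`(M', a')` with `|M' − M| + |a' − a| ≤ δ`) making every eternal, all-orders-tame, SILENT end that is
`δ`-slab-close (order `k`, weight `β`, at ANY epoch `c` of its clock) to Kerr `(M', a')` have a domain of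
outer communications EXACTLY a Kerr exterior `(M'', a'')` with `|M'' − M| + |a'' − a| ≤ ε`. Mechanism
(the card; cut B ⇐ B1 ∧ B2 proved in §2b): forward nonlinear stability from the chart slab — the slab data
are `δ`-close in `C^k_β`, hence in the `H^s_δ` topology of `klainerman_szeftel_kerr_stability_small_a_cauchy`
for `|a| < a₀M` (theorem; StabilityCauchy.lean:249; `(s, δ)` existential there — the prover instantiates
`(k, β)` to dominate them in the Klainerman–Nicolò class) and of `hintz_kerr_stability_subextremal_cauchy`
(claim under review) / `SlowlyRotatingKerrFrontier` beyond `a₀`; DARKNESS (`IsSilent`: zero flux through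
`𝓘⁺`, non-expanding `𝓗⁺`) ⇒ the Teukolsky seeds of the deviation from the final Kerr have zero future
scattering data on every characteristic rectangle `J⁺(C_u ∪ C̲_v)` issuing from the slab ⇒ they vanish
there (linear model a THEOREM: Dimock 1985, Masaood 2022/2024 — uniqueness from finite-energy radiation
fields; region form = energy identity with zero future boundary terms + backward Grönwall against the
integrable deformation, Finding C; the 1+1 shadow is LANDED, §2c; Wald 1973: zero seeds ⇒ gauge ⊕
parameters) ⇒ B1 `IsEventuallyKerrDoc`; then B2: an eternal silent tame end whose d.o.c. is eventually
exact Kerr is exact Kerr — conquering the past by infinitely many SMALL-data forward problems from earlier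
horizon-penetrating slabs (re-entered collar of width `w` Lipschitz-controlled by all-orders tameness,
step `η(Λ, M, a) > 0`; or exterior-only via thin-annulus gluing to exact collar data, Finding E (B2a/B2b)).
Why it might fail: `PriceLawTail` bites the PROOF of B1 — the stability class converges polynomially while
backward estimates from `𝓗⁺` blue-shift, so printed nonlinear uniqueness from scattering data (DHR
arXiv:1306.5364 p. 14) assumes exponential settling; the bets (α) zero news kills the AAG charges order by
order, (β) the GKS hierarchy integrated from the FUTURE boundary; for `a ≠ 0` the unsigned `O(a)`
couplings need the DHR/Ma/GKS integrated estimates (`TrappingDerivativeLoss` re-enters, r2-2 (d)). A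
polynomially decaying "dark hair" solution in the Klainerman–Szeftel class would refute it (card,
falsifier (3); none known; perturbation theory says none). Size: L–XL.
[cite: KlainermanSzeftel2023, Thm. 1.2.1] [cite: doi:10.1007/bf00759679, Thm. 1] [cite: doi:10.1016/j.aim.2024.109785, Thm 1]
[cite: doi:10.1063/1.1666203, §IV] [cite: arXiv:1306.5364, §1.1.5] -/
def DarkFutureExactness : Prop :=
    ∀ (Λ : ℕ → ℝ≥0) (r₀ : ℝ) (M a : ℝ), 0 < M → |a| < M →
      ∀ ρ : ℝ, Kerr.rMinus M a < ρ → ρ < Kerr.rPlus M a → ∃ (k : ℕ) (β : ℝ), β < 2 ∧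
      ∀ ε > (0 : ℝ), ∃ δ > (0 : ℝ), ∀ M' a' : ℝ, |M' - M| + |a' - a| ≤ δ →
        ∀ (𝓢 : Spacetime.{0} 4) (E : EndDatum 𝓢) (c : ℝ), IsTameClass E Λ r₀ → E.IsSilent →
          IsSlabClose 𝓢 E M' a' ρ k β c δ →
            ∃ M'' a'' : ℝ, 0 < M'' ∧ |a''| < M'' ∧ |M'' - M| + |a'' - a| ≤ ε ∧
              IsKerrDoc 𝓢 E.doc M'' a''

/-- Registered stub `stub_darkFutureExactness` (statement = `DarkFutureExactness`, verbatim). [folklore] -/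
theorem stub_darkFutureExactness :
    ∀ (Λ : ℕ → ℝ≥0) (r₀ : ℝ) (M a : ℝ), 0 < M → |a| < M →
      ∀ ρ : ℝ, Kerr.rMinus M a < ρ → ρ < Kerr.rPlus M a → ∃ (k : ℕ) (β : ℝ), β < 2 ∧
      ∀ ε > (0 : ℝ), ∃ δ > (0 : ℝ), ∀ M' a' : ℝ, |M' - M| + |a' - a| ≤ δ →
        ∀ (𝓢 : Spacetime.{0} 4) (E : EndDatum 𝓢) (c : ℝ), IsTameClass E Λ r₀ → E.IsSilent →
          IsSlabClose 𝓢 E M' a' ρ k β c δ →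
            ∃ M'' a'' : ℝ, 0 < M'' ∧ |a''| < M'' ∧ |M'' - M| + |a'' - a| ≤ ε ∧
              IsKerrDoc 𝓢 E.doc M'' a'' := by
  sorry

/-- **Stub K — `KerrLocusClopen` (the ∀→∃ CONVERSION, the card's claim on the crux; L; topology + two
monotone budgets, no open rigidity inside).** For a development as in Φ and a class `(Λ, r₀)` with
precompactness of the generator hull (A(b)) and WINDOW ISOLATION along generators (`P ∘ B`): along every
horizon generator path `γ`, if SOME horizon-hull element is a SUB-EXTREMAL Kerr d.o.c. (N1's witness),
then there is ONE sub-extremal `(M, a)` such that EVERY horizon-hull element along `γ` has d.o.c.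
isometric to the Kerr exterior `(M, a)`. Proof shape (IKCH K minus Birkhoff minimality, so the trimming
defect of `IsOwnHullElement`/`IsMinimalEnd` does not arise): the pointed `C²_loc` topology on `Ω_γ`
(limits along `γ ∘ s`, `sₙ → ∞`) is compact (precompactness + diagonal closedness,
`SubconvergesLocallyTo.trans`) and CONNECTED (`s ↦ (𝒟, γ s)` continuous; `…RHullDichotomy`,
`…RHullConnectednessIVT`); PINNING: the horizon area along `γ` is monotone (area theorem) hence constant on
limits, and the hole's mass is of bounded variation (absorbed energy ≤ Bondi loss, extracted ≤ `M − M_irr`),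
so every Kerr element along `γ` has parameters in the finite set `{(M, ±a)}` fixed by the witness; the Kerr
locus at FIXED parameters is CLOSED (limits of exactly-Kerr d.o.c.s based on their horizon are exactly Kerr:
base points on the horizon forbid degeneration to flat) and OPEN (elements near a Kerr-d.o.c. element admit,
at a late chart-time translate, exterior windows `C²`-close to it inside their d.o.c. — ONLY the exterior is
tested, so no interior-collar rigidity of the Kerr element is needed, answering IKCH K gap (iv) — and window
isolation returns Kerr with `ε`-near, hence pinned, parameters); the sign of `a` cannot flip on a connected
set unless `a = 0`. Why it might fail: only through the budget inputs (area theorem for the development's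
horizon along `γ`, horizon lineage of limits, doc-semicontinuity `φⱼ(window) ⊆ Eⱼ.doc` under hull
convergence) — statement-level it is point-set topology. Size: L.
[cite: Hale1980, Ch. I §8 Thm. 8.1] [cite: ChruscielEtAl2001, Thm 1.1] [cite: HawkingEllis1973, §9.2] -/
def KerrLocusClopen : Prop :=
    ∀ (X : Type) [TopologicalSpace X] [ChartedSpace E3 X] [IsManifold (𝓡 3) ∞ X] [T2Space X]
      [SecondCountableTopology X] [ConnectedSpace X], ∀ D ∈ admissibleVacuumData X,
      ∀ (𝒟 : VacuumCauchyDevelopment D) [𝒟.metric.HasLeviCivita], DevHyp 𝒟 →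
        ∀ (Λ : ℕ → ℝ≥0) (r₀ : ℝ), 0 < r₀ → GeneratorHullExists 𝒟 Λ r₀ → WindowIsolationAlong 𝒟 Λ r₀ →
          ∀ γ : ℝ → 𝒟.carrier, IsHorizonPath 𝒟 γ →
            (∃ (𝓢 : Spacetime.{0} 4) (E : EndDatum 𝓢) (p : 𝓢.carrier),
              IsHorizonHullElement 𝒟 Λ r₀ γ 𝓢 E p ∧
                ∃ M a : ℝ, 0 < M ∧ |a| < M ∧ IsKerrDoc 𝓢 E.doc M a) →
            ∃ M a : ℝ, 0 < M ∧ |a| < M ∧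
              ∀ (𝓢 : Spacetime.{0} 4) (E : EndDatum 𝓢) (p : 𝓢.carrier),
                IsHorizonHullElement 𝒟 Λ r₀ γ 𝓢 E p → IsKerrDoc 𝓢 E.doc M a

/-- Registered stub `stub_kerrLocusClopen` (statement = `KerrLocusClopen`, verbatim). [folklore] -/
theorem stub_kerrLocusClopen :
    ∀ (X : Type) [TopologicalSpace X] [ChartedSpace E3 X] [IsManifold (𝓡 3) ∞ X] [T2Space X]
      [SecondCountableTopology X] [ConnectedSpace X], ∀ D ∈ admissibleVacuumData X,
      ∀ (𝒟 : VacuumCauchyDevelopment D) [𝒟.metric.HasLeviCivita], DevHyp 𝒟 →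
        ∀ (Λ : ℕ → ℝ≥0) (r₀ : ℝ), 0 < r₀ → GeneratorHullExists 𝒟 Λ r₀ → WindowIsolationAlong 𝒟 Λ r₀ →
          ∀ γ : ℝ → 𝒟.carrier, IsHorizonPath 𝒟 γ →
            (∃ (𝓢 : Spacetime.{0} 4) (E : EndDatum 𝓢) (p : 𝓢.carrier),
              IsHorizonHullElement 𝒟 Λ r₀ γ 𝓢 E p ∧
                ∃ M a : ℝ, 0 < M ∧ |a| < M ∧ IsKerrDoc 𝓢 E.doc M a) →
            ∃ M a : ℝ, 0 < M ∧ |a| < M ∧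
              ∀ (𝓢 : Spacetime.{0} 4) (E : EndDatum 𝓢) (p : 𝓢.carrier),
                IsHorizonHullElement 𝒟 Λ r₀ γ 𝓢 E p → IsKerrDoc 𝓢 E.doc M a := by
  sorry

/-- **Stub N — `SomeLimitIsKerr` (THE HONEST OPEN CORE, `[open-problem]`; = the card's Transfer C⁺
NONEMPTINESS in ∃-form, plus the horizonless census; HARDEST).** (N1) For a development as in Φ, a class
`(Λ, r₀)` in which horizon-hull elements exist along every generator path and subsequence, and every
horizon generator path `γ`: SOME horizon-hull element along `γ` has domain of outer communications
isometric to a SUB-EXTREMAL Kerr exterior (`0 < M`, `|a| < M`). WHY THE ∃-FORM IS THE RIGHT CORE (the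
card's why-easier, checked by TRIAGE-r2-3 (5): it converts Φ only TOGETHER with the two-sided bridge B,
the producer P and K — all filed): one good epoch sequence suffices, so every averaged/integrated mechanism
(a space-time `L²` bound on the Kerr deviation along the flow gives a density-one set of good epochs),
topological-dynamics selection on the compact connected `Ω_γ` (Birkhoff-minimal / uniformly recurrent
elements need rigidity for ONE selected element: IKCH-R verbatim, now asked of one element) or variational
selection (minimise the window deviation over `Ω_γ`) feeds it, where the ∀-form demanded pointwise-in-time
convergence. Honest residue: ⊇ {uniformly recurrent dark tame vacuum end ⇒ stationary} ∘ {stationary dark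
⇒ Kerr: Alexakis–Ionescu–Klainerman small / analyticity / `EternalStationaryExteriorIsKerr` stmt-10745},
and ⊇ hypothesis (i) IN ω-LIMIT FORM (sub-extremality of the selected element: (i) as typed excludes only
CHARTS converging along all times — `ExtremalLimitPromotion`, TSOA dead note; the cold/extremal census
`NoExtremalShadow` sits here, named). (N2) HORIZONLESS BRANCH (census class (D), IKCH R2 verbatim over the
all-orders class): a silent outer hull element OF A DEVELOPMENT AS IN Φ whose end has EMPTY future event
horizon is Minkowski space or has a sub-extremal Kerr d.o.c. (far-based views of the hole; no dark
horizonless tame lumps — its perturbative part is the card's flat branch: slab-close to Minkowski + dark ⇒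
all ADM mass radiated (`christodoulou_klainerman_stability_minkowski`) ⇒ `M_ADM = 0` ⇒ positive-mass
rigidity ⇒ `IsMinkowski`; as a statement about bare ends it would be false by the extremal white-hole
patch of `Negative/EmptyHorizonEnd`, whence the restriction to hull elements). Why it might fail: (N1) ⊇
smooth stationary no-hair for non-degenerate horizons restricted to ONE recurrent element per generator —
a smooth non-Kerr stationary vacuum black hole realised as an ω-limit (census (U)) refutes it, as does an
eternal dark tame breather hull (B); (N2) ⊇ large-data non-existence of dark vacuum geons. Size: XL / open
problem. [cite: arXiv:1504.04592, Thm 1.3] [cite: AlexakisIonescuKlainerman2009, Thm 1.1] [cite: IonescuKlainerman2012, Thm 1.1]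
[cite: doi:10.1090/coll/009, Ch. VII §7] [cite: ChristodoulouKlainerman1993, Thm. 1.0.2] -/
def SomeLimitIsKerr : Prop :=
    (∀ (X : Type) [TopologicalSpace X] [ChartedSpace E3 X] [IsManifold (𝓡 3) ∞ X] [T2Space X]
      [SecondCountableTopology X] [ConnectedSpace X], ∀ D ∈ admissibleVacuumData X,
      ∀ (𝒟 : VacuumCauchyDevelopment D) [𝒟.metric.HasLeviCivita], DevHyp 𝒟 →
        ∀ (Λ : ℕ → ℝ≥0) (r₀ : ℝ), 0 < r₀ → GeneratorHullExists 𝒟 Λ r₀ →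
          ∀ γ : ℝ → 𝒟.carrier, IsHorizonPath 𝒟 γ →
            ∃ (𝓢 : Spacetime.{0} 4) (E : EndDatum 𝓢) (p : 𝓢.carrier),
              IsHorizonHullElement 𝒟 Λ r₀ γ 𝓢 E p ∧
                ∃ M a : ℝ, 0 < M ∧ |a| < M ∧ IsKerrDoc 𝓢 E.doc M a) ∧
      ∀ (X : Type) [TopologicalSpace X] [ChartedSpace E3 X] [IsManifold (𝓡 3) ∞ X] [T2Space X]
      [SecondCountableTopology X] [ConnectedSpace X], ∀ D ∈ admissibleVacuumData X,
      ∀ (𝒟 : VacuumCauchyDevelopment D) [𝒟.metric.HasLeviCivita], DevHyp 𝒟 →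
        ∀ (Λ : ℕ → ℝ≥0) (r₀ : ℝ) (q : ℕ → 𝒟.carrier) (𝓢 : Spacetime.{0} 4) (E : EndDatum 𝓢)
          (p : 𝓢.carrier), IsSilentHullElement 𝒟 Λ r₀ q 𝓢 E p → E.horizon = ∅ →
          IsMinkowski 𝓢 ∨ ∃ M a : ℝ, 0 < M ∧ |a| < M ∧ IsKerrDoc 𝓢 E.doc M a

/-- Registered stub `stub_someLimitIsKerr` (statement = `SomeLimitIsKerr`, verbatim). [folklore] -/
theorem stub_someLimitIsKerr :
    (∀ (X : Type) [TopologicalSpace X] [ChartedSpace E3 X] [IsManifold (𝓡 3) ∞ X] [T2Space X]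
      [SecondCountableTopology X] [ConnectedSpace X], ∀ D ∈ admissibleVacuumData X,
      ∀ (𝒟 : VacuumCauchyDevelopment D) [𝒟.metric.HasLeviCivita], DevHyp 𝒟 →
        ∀ (Λ : ℕ → ℝ≥0) (r₀ : ℝ), 0 < r₀ → GeneratorHullExists 𝒟 Λ r₀ →
          ∀ γ : ℝ → 𝒟.carrier, IsHorizonPath 𝒟 γ →
            ∃ (𝓢 : Spacetime.{0} 4) (E : EndDatum 𝓢) (p : 𝓢.carrier),
              IsHorizonHullElement 𝒟 Λ r₀ γ 𝓢 E p ∧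
                ∃ M a : ℝ, 0 < M ∧ |a| < M ∧ IsKerrDoc 𝓢 E.doc M a) ∧
      ∀ (X : Type) [TopologicalSpace X] [ChartedSpace E3 X] [IsManifold (𝓡 3) ∞ X] [T2Space X]
      [SecondCountableTopology X] [ConnectedSpace X], ∀ D ∈ admissibleVacuumData X,
      ∀ (𝒟 : VacuumCauchyDevelopment D) [𝒟.metric.HasLeviCivita], DevHyp 𝒟 →
        ∀ (Λ : ℕ → ℝ≥0) (r₀ : ℝ) (q : ℕ → 𝒟.carrier) (𝓢 : Spacetime.{0} 4) (E : EndDatum 𝓢)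
          (p : 𝓢.carrier), IsSilentHullElement 𝒟 Λ r₀ q 𝓢 E p → E.horizon = ∅ →
          IsMinkowski 𝓢 ∨ ∃ M a : ℝ, 0 < M ∧ |a| < M ∧ IsKerrDoc 𝓢 E.doc M a := by
  sorry

/-- **Stub T — `TameEndgame` (IKCH T re-targeted to K2R♭: `IsFutureOriented` added, parameters
sub-extremal; XL assembly, no open rigidity inside).** For a development as in Φ WITH NONEMPTY OUTER REGION
(Reshape 1 guard: on the fibre `outerRegion 𝒟 = ∅` all of (a)–(d) below are vacuous and T would contain Φ♭;
the nonemptiness is supplied by A′), suppose in one class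
`(Λ, r₀)`: (a) silent outer hull elements exist along every future-escaping outer sequence; (b)
horizon-hull elements exist along every generator path; (c) every silent outer hull element is Minkowski
or has a sub-extremal Kerr d.o.c.; (d) PARAMETER CONSTANCY: along every horizon generator path ALL
horizon-hull elements have d.o.c. isometric to ONE sub-extremal Kerr exterior `(M_γ, a_γ)`. Then the K2R♭
conclusion holds: an honest `FinalStateDecomposition … O 2` with `O = exteriorOf 𝒟 d.charted`,
`HasExhaustiveCharts d` and `IsFutureOriented d`. Content ("soft" but real, as recorded for IKCH T / KID
S6 / TSOA S7): finiteness and eventual constancy of late horizon components (curvature quantum), generators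
of one component carry the same `(M, a)` (overlapping windows); CHART GLUING with `o(1)`-drifting
Poincaré/axis moduli (rigidity of local isometries of Kerr); separation of holes; the FLAT CHART with full
`C²` decay on `{x⁰ = τ} ∖ tubes` (`DispersiveRadiationChart`: Bondi mass → Σ Mᵢ, no energy parked — (c)
for escaping sequences + the uniform far constants); `O = exteriorOf`, exhaustion by horizon-normalised
charts and causal bookkeeping (`…RFutureEscapingPaths`, p118990); `IsFutureOriented` is one lemma once
the charts are honest (`Disproof` §8.3, `Negative/SubMinkowskiOrientation`). Why it might fail: the
`C²`-metric ⇒ `C³`-diffeomorphism bootstrap across infinitely many gluings must not lose uniformity;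
Bondi mass/news over `CauchyDevelopment` are not yet defined in the tree. Size: XL.
[cite: DafermosLuk2017, Conjecture 1] [cite: arXiv:2104.08222, §1] [cite: KobayashiNomizu1963, VI Thm 6.2]
[cite: ChristodoulouKlainerman1993, Thm. 1.0.2] -/
def TameEndgame : Prop :=
    ∀ (X : Type) [TopologicalSpace X] [ChartedSpace E3 X] [IsManifold (𝓡 3) ∞ X] [T2Space X]
      [SecondCountableTopology X] [ConnectedSpace X], ∀ D ∈ admissibleVacuumData X,
      ∀ (𝒟 : VacuumCauchyDevelopment D) [𝒟.metric.HasLeviCivita], DevHyp 𝒟 →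
        (outerRegion 𝒟).Nonempty →
        (∃ (Λ : ℕ → ℝ≥0) (r₀ : ℝ), 0 < r₀ ∧ OuterHullExists 𝒟 Λ r₀ ∧ GeneratorHullExists 𝒟 Λ r₀ ∧
          (∀ (q : ℕ → 𝒟.carrier) (𝓢 : Spacetime.{0} 4) (E : EndDatum 𝓢) (p : 𝓢.carrier),
            IsSilentHullElement 𝒟 Λ r₀ q 𝓢 E p →
              IsMinkowski 𝓢 ∨ ∃ M a : ℝ, 0 < M ∧ |a| < M ∧ IsKerrDoc 𝓢 E.doc M a) ∧
          (∀ γ : ℝ → 𝒟.carrier, IsHorizonPath 𝒟 γ → ∃ M a : ℝ, 0 < M ∧ |a| < M ∧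
            ∀ (𝓢 : Spacetime.{0} 4) (E : EndDatum 𝓢) (p : 𝓢.carrier),
              IsHorizonHullElement 𝒟 Λ r₀ γ 𝓢 E p → IsKerrDoc 𝓢 E.doc M a)) →
        ∃ (O : Set 𝒟.carrier) (d : FinalStateDecomposition 𝒟.toSpacetime O 2),
          O = _root_.Summit.FinalStateConjecture.exteriorOf 𝒟.toCauchyDevelopment d.charted ∧
            _root_.Summit.FinalStateConjecture.HasExhaustiveCharts d ∧
              _root_.Summit.FinalStateConjecture.IsFutureOriented d

/-- Registered stub `stub_tameEndgame` (statement = `TameEndgame`, verbatim). [folklore] -/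
theorem stub_tameEndgame :
    ∀ (X : Type) [TopologicalSpace X] [ChartedSpace E3 X] [IsManifold (𝓡 3) ∞ X] [T2Space X]
      [SecondCountableTopology X] [ConnectedSpace X], ∀ D ∈ admissibleVacuumData X,
      ∀ (𝒟 : VacuumCauchyDevelopment D) [𝒟.metric.HasLeviCivita], DevHyp 𝒟 →
        (outerRegion 𝒟).Nonempty →
        (∃ (Λ : ℕ → ℝ≥0) (r₀ : ℝ), 0 < r₀ ∧ OuterHullExists 𝒟 Λ r₀ ∧ GeneratorHullExists 𝒟 Λ r₀ ∧
          (∀ (q : ℕ → 𝒟.carrier) (𝓢 : Spacetime.{0} 4) (E : EndDatum 𝓢) (p : 𝓢.carrier),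
            IsSilentHullElement 𝒟 Λ r₀ q 𝓢 E p →
              IsMinkowski 𝓢 ∨ ∃ M a : ℝ, 0 < M ∧ |a| < M ∧ IsKerrDoc 𝓢 E.doc M a) ∧
          (∀ γ : ℝ → 𝒟.carrier, IsHorizonPath 𝒟 γ → ∃ M a : ℝ, 0 < M ∧ |a| < M ∧
            ∀ (𝓢 : Spacetime.{0} 4) (E : EndDatum 𝓢) (p : 𝓢.carrier),
              IsHorizonHullElement 𝒟 Λ r₀ γ 𝓢 E p → IsKerrDoc 𝓢 E.doc M a)) →
        ∃ (O : Set 𝒟.carrier) (d : FinalStateDecomposition 𝒟.toSpacetime O 2),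
          O = _root_.Summit.FinalStateConjecture.exteriorOf 𝒟.toCauchyDevelopment d.charted ∧
            _root_.Summit.FinalStateConjecture.HasExhaustiveCharts d ∧
              _root_.Summit.FinalStateConjecture.IsFutureOriented d := by
  sorry

/-- **Stub C — `SettledExteriorHoldsRays` = item stmt-FinalStateConjecture-17673 VERBATIM (DOCK: the
cross-route item of `Theses.TangentConeAtIPlus` rank 6 / `Theses.RaychaudhuriBlowdown` rank 6; when it is
proved this stub closes by `exact`).** The ray-closure clause (C) of the T2 consequent: for every
admissible datum, every MGHD with complete `𝓘⁺` and every sub-extremal honest exhaustive future-oriented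
`2`-decomposition `fd` of `O = exteriorOf 𝒟 fd.charted`, every future-complete normalised null ray from
`Σ` stays in `closure O`. It is the one clause of the crux whose truth on multi-topology `Σ = ℝ³ # N` is an
OPERATOR-level question (`Disproof` §8.2 `bag_exposure`, `BAG.md`); docking it here (landed split
`RayClause.channelsResolveTameDevelopmentsR_of_rayClause`) keeps that exposure on the shared item and out of
the line's six Φ-stubs. Why it might fail: a hidden expanding vacuum bag behind a CIP-glued neck carries
future-complete rays outside `closure O` (paper-conditional). Size: item (rank 6, two routes).
[cite: DafermosLuk2017, Conjecture 1] [cite: arXiv:gr-qc/0403066, Thm. 1.1] -/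
def SettledExteriorHoldsRays : Prop :=
    ∀ (X : Type) [TopologicalSpace X] [ChartedSpace E3 X] [IsManifold (𝓡 3) ∞ X] [T2Space X]
      [SecondCountableTopology X] [ConnectedSpace X] (D : InitialDataSet (𝓡 3) X),
      D ∈ admissibleVacuumData X → ∀ 𝒟 : VacuumCauchyDevelopment D, 𝒟.IsMaximal →
      _root_.Summit.FinalStateConjecture.HasCompleteNullInfinity 𝒟.toCauchyDevelopment →
      ∀ (O : Set 𝒟.carrier) (fd : FinalStateDecomposition 𝒟.toSpacetime O 2),
      (∀ i, Kerr.IsSubextremal (fd.mass i) (fd.spin i)) →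
      O = _root_.Summit.FinalStateConjecture.exteriorOf 𝒟.toCauchyDevelopment fd.charted →
      _root_.Summit.FinalStateConjecture.HasExhaustiveCharts fd →
      _root_.Summit.FinalStateConjecture.IsFutureOriented fd →
      _root_.Summit.FinalStateConjecture.RaysStayInClosure 𝒟.toCauchyDevelopment O

/-- Registered stub `stub_settledExteriorHoldsRays` (statement = `SettledExteriorHoldsRays` = item
stmt-FinalStateConjecture-17673, verbatim). [folklore] -/
theorem stub_settledExteriorHoldsRays :
    ∀ (X : Type) [TopologicalSpace X] [ChartedSpace E3 X] [IsManifold (𝓡 3) ∞ X] [T2Space X]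
      [SecondCountableTopology X] [ConnectedSpace X] (D : InitialDataSet (𝓡 3) X),
      D ∈ admissibleVacuumData X → ∀ 𝒟 : VacuumCauchyDevelopment D, 𝒟.IsMaximal →
      _root_.Summit.FinalStateConjecture.HasCompleteNullInfinity 𝒟.toCauchyDevelopment →
      ∀ (O : Set 𝒟.carrier) (fd : FinalStateDecomposition 𝒟.toSpacetime O 2),
      (∀ i, Kerr.IsSubextremal (fd.mass i) (fd.spin i)) →
      O = _root_.Summit.FinalStateConjecture.exteriorOf 𝒟.toCauchyDevelopment fd.charted →
      _root_.Summit.FinalStateConjecture.HasExhaustiveCharts fd →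
      _root_.Summit.FinalStateConjecture.IsFutureOriented fd →
      _root_.Summit.FinalStateConjecture.RaysStayInClosure 𝒟.toCauchyDevelopment O := by
  sorry

/-! ### §2b The foreseen cut of B (gate-level sub-goals, NOT registered stubs): B ⇐ B1 ∧ B2, proved -/

/-- **B1 — `ForwardExactness` (forward stability + zero scattering data ⇒ exact Kerr on the late
d.o.c.; a = 0 first, REGION form, TRIAGE-r2-2/r2-3 `sharpen`).** Same quantifier shape as B, conclusion
`IsEventuallyKerrDoc`: the d.o.c. is exactly Kerr `(M'', a'')` to the future of some clock time. The KS /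
Hintz black box gives convergence in `C^k` to SOME Kerr on `J⁺` of the slab; darkness makes every
characteristic rectangle `{u ≥ u₀, v ≥ v₀}` issuing from the slab carry zero future fluxes, and the
`T`-energy identity with zero boundary terms + backward Grönwall against the integrable deformation of the
background kills the gauge-invariant seeds there (Finding C; linear model Dimock/Masaood; Wald: zero seeds ⇒
gauge ⊕ parameters). [cite: doi:10.1016/j.aim.2024.109785, Thm 1] [cite: KlainermanSzeftel2023, Thm. 1.2.1] -/
def ForwardExactness : Prop :=
    ∀ (Λ : ℕ → ℝ≥0) (r₀ : ℝ) (M a : ℝ), 0 < M → |a| < M →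
      ∀ ρ : ℝ, Kerr.rMinus M a < ρ → ρ < Kerr.rPlus M a → ∃ (k : ℕ) (β : ℝ), β < 2 ∧
      ∀ ε > (0 : ℝ), ∃ δ > (0 : ℝ), ∀ M' a' : ℝ, |M' - M| + |a' - a| ≤ δ →
        ∀ (𝓢 : Spacetime.{0} 4) (E : EndDatum 𝓢) (c : ℝ), IsTameClass E Λ r₀ → E.IsSilent →
          IsSlabClose 𝓢 E M' a' ρ k β c δ →
            ∃ M'' a'' : ℝ, 0 < M'' ∧ |a''| < M'' ∧ |M'' - M| + |a'' - a| ≤ ε ∧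
              IsEventuallyKerrDoc 𝓢 E M'' a''

/-- **B2 — `BackwardExtension` (Finding E of TRIAGE-r2-3, "the card's real idea, worth stating so"): an
eternal, all-orders-tame, SILENT end whose d.o.c. is EVENTUALLY exactly a sub-extremal Kerr exterior is
EXACTLY a Kerr exterior.** Not "free by Cauchy rigidity" (the past Cauchy horizon `N = {v = v_K}` of the
exact late piece never moves under re-slabbing): each backward step RE-RUNS the small-data forward problem +
exactness from an earlier horizon-penetrating slab whose re-entered collar `(M, r₊]` of width `w` is only
Lipschitz-controlled from `N` by tameness, `‖Dʲ dev‖ ≤ Λ_{j+1}(η + w)`; gain `η(Λ, M, a) > 0` per step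
uniformly ⇒ all of `E.doc` (B2a: thin-collar smallness against `ε_KS(M, a, r₁)`; B2b: exterior-only, glue
the exterior data to EXACT Kerr collar data across `r₊` by thin-annulus constraint gluing with
`(M, a)`-adjustment and read off the exterior future by domain of dependence). Equivalently: no dark
heteroclinic connection INTO Kerr exists in the class. [cite: KlainermanSzeftel2023, §3.4.1] [cite: arXiv:1306.5364, §1.1.5] -/
def BackwardExtension : Prop :=
    ∀ (𝓢 : Spacetime.{0} 4) (E : EndDatum 𝓢) (Λ : ℕ → ℝ≥0) (r₀ : ℝ) (M a : ℝ),
      IsTameClass E Λ r₀ → E.IsSilent → 0 < M → |a| < M →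
        IsEventuallyKerrDoc 𝓢 E M a → IsKerrDoc 𝓢 E.doc M a

/-- **B from its cut: `ForwardExactness → BackwardExtension → DarkFutureExactness`** (pure logic; the
lead may `--resplit` B into B1, B2 at a cycle boundary without touching `ChannelsResolveTameDevelopmentsR_of`). -/
theorem darkFutureExactness_of_forward_backward (h₁ : ForwardExactness) (h₂ : BackwardExtension) :
    DarkFutureExactness := by
  intro Λ r₀ M a hM ha ρ hρ₁ hρ₂
  obtain ⟨k, β, hβ, h⟩ := h₁ Λ r₀ M a hM ha ρ hρ₁ hρ₂
  refine ⟨k, β, hβ, fun ε hε ↦ ?_⟩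
  obtain ⟨δ, hδ, hδ'⟩ := h ε hε
  refine ⟨δ, hδ, fun M' a' hnear 𝓢 E c hcls hsil hslab ↦ ?_⟩
  obtain ⟨M'', a'', hM'', ha'', hnear', hev⟩ := hδ' M' a' hnear 𝓢 E c hcls hsil hslab
  exact ⟨M'', a'', hM'', ha'', hnear', h₂ 𝓢 E Λ r₀ M'' a'' hcls hsil hM'' ha'' hev⟩

/-! ### §2c The 1+1 linear shadow of B1 is a THEOREM of the tree (card's first lemma, LANDED p-accepted
`Theorems/…RLateSilentCone.lean`, lead c6): late silence at ONE apex empties its solid forward cone -/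

/-- **`LateSilentConeIsEmpty`** (the card's first lemma, verbatim; sorry-free re-export of the landed
`Theorems.RW.lateSilentConeIsEmpty`): for a finite-energy global `C²` Regge–Wheeler solution and ANY apex
`(B, x₀)`, if the forward channel energy of `ψ(B + ·)` through the bare light cone about `x₀` is the whole
energy (no flux to `𝓘⁺` after `u = B − x₀`, none into `𝓗⁺` after `v = B + x₀`), then `ψ` vanishes on the
closed solid forward cone — the 1+1 shadow of "zero future boundary terms on the characteristic rectangle ⇒
nothing there" (B1). Honours `Negative/SilenceCalculus.not_oneTimeSilenceZero`: one apex, conclusion on ITS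
cone only. [folklore] -/
theorem lateSilentConeIsEmpty :
    ∀ (M : ℝ), 0 < M → ∀ (r : ℝ → ℝ) (xc : ℝ), ReggeWheeler.IsTortoiseRadius M r xc →
      ∀ (s ℓ : ℕ), s ≤ ℓ → ∀ ψ : ℝ → ℝ → ℝ, ReggeWheeler.IsRWSolution M s ℓ r ψ →
        ReggeWheeler.totalEnergy (ReggeWheeler.linePotential M s ℓ r) ψ 0 < (⊤ : ℝ≥0∞) →
          ∀ (B x₀ : ℝ),
            ReggeWheeler.channelEnergy (ReggeWheeler.linePotential M s ℓ r) x₀ 0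
                (fun t x ↦ ψ (B + t) x) atTop =
              ReggeWheeler.totalEnergy (ReggeWheeler.linePotential M s ℓ r) ψ 0 →
            ∀ (t x : ℝ), 0 ≤ t → |x - x₀| ≤ t → ψ (B + t) x = 0 :=
  Summit.FinalStateConjecture.FinalStateConjecture.Theorems.RW.lateSilentConeIsEmpty

/-! ### §3 Name-keyed aliases of the registered stubs; consistency -/

namespace Registered
/-- Statement of `stub_silentHull` (= `SilentHull`). [folklore] -/
abbrev stub_silentHull : Prop := SilentHull
/-- Statement of `stub_hullNearKerrIsSlabClose` (= `HullNearKerrIsSlabClose`). [folklore] -/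
abbrev stub_hullNearKerrIsSlabClose : Prop := HullNearKerrIsSlabClose
/-- Statement of `stub_darkFutureExactness` (= `DarkFutureExactness`). [folklore] -/
abbrev stub_darkFutureExactness : Prop := DarkFutureExactness
/-- Statement of `stub_kerrLocusClopen` (= `KerrLocusClopen`). [folklore] -/
abbrev stub_kerrLocusClopen : Prop := KerrLocusClopen
/-- Statement of `stub_someLimitIsKerr` (= `SomeLimitIsKerr`). [folklore] -/
abbrev stub_someLimitIsKerr : Prop := SomeLimitIsKerr
/-- Statement of `stub_tameEndgame` (= `TameEndgame`). [folklore] -/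
abbrev stub_tameEndgame : Prop := TameEndgame
/-- Statement of `stub_settledExteriorHoldsRays` (= `SettledExteriorHoldsRays`). [folklore] -/
abbrev stub_settledExteriorHoldsRays : Prop := SettledExteriorHoldsRays
end Registered

/-- Consistency check: the registered (sorried) stubs prove their name-keyed statements, i.e. the texts
of `stub_X`, `X` and `Registered.stub_X` agree. -/
example : Registered.stub_silentHull ∧ Registered.stub_hullNearKerrIsSlabClose ∧
    Registered.stub_darkFutureExactness ∧ Registered.stub_kerrLocusClopen ∧
    Registered.stub_someLimitIsKerr ∧ Registered.stub_tameEndgame ∧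
    Registered.stub_settledExteriorHoldsRays :=
  ⟨stub_silentHull, stub_hullNearKerrIsSlabClose, stub_darkFutureExactness, stub_kerrLocusClopen,
    stub_someLimitIsKerr, stub_tameEndgame, stub_settledExteriorHoldsRays⟩

/-! ### §4 The composition (kernel-checked, no `sorry` of its own): the crux BY NAME -/

section Composition

variable {X : Type} [TopologicalSpace X] [ChartedSpace E3 X] [IsManifold (𝓡 3) ∞ X]
  [T2Space X] [SecondCountableTopology X] [ConnectedSpace X] {D : InitialDataSet (𝓡 3) X}

omit [T2Space X] [SecondCountableTopology X] in
/-- **Window isolation along generators from the producer and the bridge (`P ∘ B`)**, for one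
development and one class: B's `(k, β)` and locally uniform `δ` are fed to P as its order, weight and
tolerance. Pure logic. -/
theorem windowIsolationAlong_of_producer_bridge {𝒟 : VacuumCauchyDevelopment D}
    [𝒟.metric.HasLeviCivita] {Λ : ℕ → ℝ≥0} {r₀ : ℝ}
    (hP : ∀ γ : ℝ → 𝒟.carrier, IsHorizonPath 𝒟 γ →
      ∀ M a : ℝ, 0 < M → |a| < M →
        ∃ (ρ : ℝ) (Λ' : ℕ → ℝ≥0) (r₀' : ℝ), Kerr.rMinus M a < ρ ∧ ρ < Kerr.rPlus M a ∧
        ∀ (k : ℕ) (β : ℝ), β < 2 → ∀ ε > (0 : ℝ),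
        ∃ W η δ : ℝ, 0 < η ∧ 0 < δ ∧
          ∀ (𝓢 : Spacetime.{0} 4) (E : EndDatum 𝓢) (p : 𝓢.carrier),
            IsHorizonHullElement 𝒟 Λ r₀ γ 𝓢 E p → IsExteriorWindowClose 𝓢 E M a W η δ →
              ∃ (𝓢' : Spacetime.{0} 4) (E' : EndDatum 𝓢') (p' : 𝓢'.carrier) (M' a' c : ℝ),
                IsHorizonHullElement 𝒟 Λ' r₀' γ 𝓢' E' p' ∧ |M' - M| + |a' - a| ≤ ε ∧
                  IsSlabClose 𝓢' E' M' a' ρ k β c ε ∧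
                    ∀ M'' a'' : ℝ, IsKerrDoc 𝓢' E'.doc M'' a'' → IsKerrDoc 𝓢 E.doc M'' a'')
    (hB : DarkFutureExactness) : WindowIsolationAlong 𝒟 Λ r₀ := by
  intro γ hγ M a hM ha ε hε
  obtain ⟨ρ, Λ', r₀', hρ₁, hρ₂, hPρ⟩ := hP γ hγ M a hM ha
  obtain ⟨k, β, hβ, hBk⟩ := hB Λ' r₀' M a hM ha ρ hρ₁ hρ₂
  obtain ⟨δ, hδ, hBδ⟩ := hBk ε hε
  obtain ⟨W, η, δw, hη, hδw, hPW⟩ := hPρ k β hβ δ hδ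
  refine ⟨W, η, δw, hη, hδw, fun 𝓢 E p hZ hwin ↦ ?_⟩
  obtain ⟨𝓢', E', p', M', a', c, hZ', hnear, hslab, htransfer⟩ := hPW 𝓢 E p hZ hwin
  obtain ⟨s, _hs, hcls, hsil, _hp, _hsub⟩ := hZ'
  obtain ⟨M'', a'', hM'', ha'', hnear'', hdoc⟩ := hBδ M' a' hnear 𝓢' E' c hcls hsil hslab
  exact ⟨M'', a'', hM'', ha'', hnear'', htransfer M'' a'' hdoc⟩

end Composition

/-- **Logic of the line: the seven stub STATEMENTS imply the crux.** K2R♭ from A, P, B, K, N, T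
(A's class; `P ∘ B ⇒` window isolation; per generator `K` applied to N1's witness; outer elements: empty
horizon ⇒ N2, else shadow (A(c)) onto a generator; T), then the crux from K2R♭ and the docked ray clause
C by the landed `RayClause.channelsResolveTameDevelopmentsR_of_rayClause`; the antecedent `K1R` is
discarded. Hypotheses (i) ∧ (ii) of the crux are definitionally `TameHull.DevHyp`'s. Sorry-free. -/
theorem channelsResolveTameDevelopmentsR_of_stubs (hA : Registered.stub_silentHull)
    (hP : Registered.stub_hullNearKerrIsSlabClose) (hB : Registered.stub_darkFutureExactness)
    (hK : Registered.stub_kerrLocusClopen) (hN : Registered.stub_someLimitIsKerr)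
    (hT : Registered.stub_tameEndgame) (hC : Registered.stub_settledExteriorHoldsRays) :
    ChannelsResolveTameDevelopmentsR := by
  refine Summit.FinalStateConjecture.FinalStateConjecture.Theorems.ChannelsResolveTameDevelopmentsR.RayClause.channelsResolveTameDevelopmentsR_of_rayClause
    hC ?_
  intro _hK1R X _ _ _ _ _ _ D hD 𝒟 hmax hscri hhyp
  haveI : 𝒟.metric.HasLeviCivita := 𝒟.metric.toPseudoRiemannianMetric.hasLeviCivita
  have hdev : DevHyp 𝒟 := ⟨hmax, hscri, hhyp.1, hhyp.2⟩
  obtain ⟨hne, Λ, r₀, hr₀, ha, hb, hc⟩ := hA X D hD 𝒟 hdev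
  -- openness of the Kerr locus along generators: P ∘ B
  have hiso : WindowIsolationAlong 𝒟 Λ r₀ :=
    windowIsolationAlong_of_producer_bridge (hP X D hD 𝒟 hdev Λ r₀) hB
  -- per generator: one sub-extremal (M, a) for all horizon-hull elements (K applied to N1's witness)
  have hgen : ∀ γ : ℝ → 𝒟.carrier, IsHorizonPath 𝒟 γ → ∃ M a : ℝ, 0 < M ∧ |a| < M ∧
      ∀ (𝓢 : Spacetime.{0} 4) (E : EndDatum 𝓢) (p : 𝓢.carrier),
        IsHorizonHullElement 𝒟 Λ r₀ γ 𝓢 E p → IsKerrDoc 𝓢 E.doc M a :=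
    fun γ hγ ↦ hK X D hD 𝒟 hdev Λ r₀ hr₀ hb hiso γ hγ (hN.1 X D hD 𝒟 hdev Λ r₀ hr₀ hb γ hγ)
  -- every silent outer hull element is flat or Kerr (N2 / shadowing + hgen)
  have houter : ∀ (q : ℕ → 𝒟.carrier) (𝓢 : Spacetime.{0} 4) (E : EndDatum 𝓢) (p : 𝓢.carrier),
      IsSilentHullElement 𝒟 Λ r₀ q 𝓢 E p →
        IsMinkowski 𝓢 ∨ ∃ M a : ℝ, 0 < M ∧ |a| < M ∧ IsKerrDoc 𝓢 E.doc M a := by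
    intro q 𝓢 E p hZ
    rcases (E.horizon).eq_empty_or_nonempty with hempty | hne
    · exact hN.2 X D hD 𝒟 hdev Λ r₀ q 𝓢 E p hZ hempty
    · obtain ⟨γ, p', hγ, hZ'⟩ := hc q 𝓢 E p hZ hne
      obtain ⟨M, a, hM, ha', hall⟩ := hgen γ hγ
      exact Or.inr ⟨M, a, hM, ha', hall 𝓢 E p' hZ'⟩
  exact hT X D hD 𝒟 hdev hne ⟨Λ, r₀, hr₀, ha, hb, houter, hgen⟩

/-- **`ChannelsResolveTameDevelopmentsR` from the line `dark-future-exactness`**: the composition applied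
to the seven registered stubs `stub_*` — the only `sorry`s of this file sit in those stubs, and this
theorem concludes the ROUTE decl by its name. When the last stub closes this is the closing theorem (to be
re-landed Theses-free under `Theorems/`, `k2R_of_tameResolution` / `RayClause` shape). -/
theorem ChannelsResolveTameDevelopmentsR_of :
    Summit.FinalStateConjecture.FinalStateConjecture.Theses.PhotonSphereChannels.ChannelsResolveTameDevelopmentsR :=
  channelsResolveTameDevelopmentsR_of_stubs stub_silentHull stub_hullNearKerrIsSlabClose
    stub_darkFutureExactness stub_kerrLocusClopen stub_someLimitIsKerr stub_tameEndgame
    stub_settledExteriorHoldsRays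

end Summit.FinalStateConjecture.FinalStateConjecture.Cruxes.ChannelsResolveTameDevelopmentsR.DarkFutureExactness

end
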